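import Summits.CriticalPhenomena.PercolationContinuityZ3.Theorems.PercNearOneGluingAdditiveGluingCSHUnfoldWorld
import Summits.CriticalPhenomena.PercolationContinuityZ3.Theorems.PercNearOneGluingAdditiveGluingCSHHtwBridge
import Summits.CriticalPhenomena.PercolationContinuityZ3.Theorems.PercNearOneGluingAdditiveGluingCSHInduction
import Summits.CriticalPhenomena.PercolationContinuityZ3.Theorems.PercNearOneGluingNoHeavyLowerTailCSHPhi
import HarnessLib

/-!
# Crux `PercNearOneGluing.AdditiveGluing` (stmt-CriticalPhenomena-4576): the conditioned slack hierarchy — the decoy part of the general unfolding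

Support file (`--supports stmt-CriticalPhenomena-4576`, lead-of-record prim-png-lead-4576 gen 12; part 2a of the GENERAL-`k` ASSEMBLY of Lemma U + Lemma H, memo
`prim-hp-8/PROOF-S5-ALL-R.md` §3.3–3.5).  No definitions, no named facts, no sorries.

* `unfoldT_world_nonpos` — the world covariance of `g(C_x)` with the unfolded decoy terms (prim-ineq-prove-1's `CSH.unfoldT`, the
  `Σ_j 1{E_j} M^{(j,k)}` of the memo), integrated over `{x ↮ Y}`, is `≤ 0` as soon as every LOWER-LEVEL margin `Marg_{L_{>j}}[covD_{d_j}(h)]` is `≥ 0`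
  (induction along the decoy list with a growing source set; each decoy contributes `−μ(E_j)⁻¹·cshMargin_j[Φ̃]` by prim-ineq-prove-1's
  `CSH.decoy_world_term`, `Φ̃` = prim-hp-8's Lemma-Φ functional read on the edge cluster of `d_j`, monotone `≥ 0` by `CSH.phiFun_mono` / `phiFun_nonneg`).
[cite: VandenbergHaggstromKahn2005, §2.1 (pp. 9–13)] [cite: KozmaNitzan2024, Conj. 1 (p. 3), Conj. 4 (p. 32)]
-/

noncomputable section

namespace Summit.CriticalPhenomena.PercolationContinuityZ3.Theorems.CSH

open MeasureTheory Set
open Literature.Probability.LatticeModels (prodBernoulli prodBernoulli_real_pos_of_nonempty)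
open Literature.Probability.Percolation Literature.Probability.Percolation.KNPreFKG
open Literature.Probability.Percolation.BHK2006 (weight ind_inter)
open DecisionTree (ind ind_of_mem ind_of_not_mem ind_nonneg)
open HullPort (cut avoidEv)
open CovTau (sum_weight_mul_eq_integral ind_eq_indicator_one sum_weight_coe_eq_one sum_weight_ind sum_weight_mul_ind)
open scoped Classical

/- ELABORATION NOTE.  The zeroed world weights `fun e => if (∃ z ∈ e, ∃ y ∈ Y, (openGraph ω).Reachable y z) then 0 else w e` must elaborate
with the SAME `Decidable` instance as in `CSH.cshMargin_nonneg_of_within` / `CSH.cshMargin_nonneg_of_unfold` (classical reachability).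
The import closure of `…CSHHpart` (via `…AdditiveGluingCovTransferSet`) brings Mathlib's computable `SimpleGraph.instDecidableRelReachable`
into scope, which would silently change the elaborated instance and make the statements syntactically incomparable; we therefore do not use
that instance in this file (the one imported statement that carries it, `CSH.hpart_nonneg`, is transported by `convert` where used). -/
attribute [-instance] SimpleGraph.instDecidableRelReachable

variable {V : Type*} [Fintype V]

omit [Fintype V] in
/-- Set bookkeeping: `{x} ∪ pre ∪ {d} = {x} ∪ (pre ++ [d])`. [folklore] -/
theorem insert_insert_setOf_mem_append (x d : V) (pre : List V) :
    (insert d (insert x {e | e ∈ pre}) : Set V) = insert x {e | e ∈ pre ++ [d]} := by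
  ext a
  simp only [mem_insert_iff, mem_setOf_eq, List.mem_append, List.mem_cons, List.not_mem_nil, or_false]
  tauto

omit [Fintype V] in
/-- Set bookkeeping: `({x} ∪ Y ∪ pre) ∪ {d} = {x} ∪ Y ∪ (pre ++ [d])`. [folklore] -/
theorem insert_union_setOf_mem_append (x d : V) (Y : Set V) (pre : List V) :
    (insert d (insert x Y ∪ {e | e ∈ pre}) : Set V) = insert x Y ∪ {e | e ∈ pre ++ [d]} := by
  ext a
  simp only [mem_insert_iff, mem_union, mem_setOf_eq, List.mem_append, List.mem_cons, List.not_mem_nil, or_false]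
  tauto

omit [Fintype V] in
/-- Set bookkeeping: `({x} ∪ pre) ∪ Y = {x} ∪ Y ∪ pre`. [folklore] -/
theorem insert_setOf_union (x : V) (Y : Set V) (pre : List V) :
    (insert x {e | e ∈ pre} ∪ Y : Set V) = insert x Y ∪ {e | e ∈ pre} := by
  ext a; simp only [mem_union, mem_insert_iff, mem_setOf_eq]; tauto

omit [Fintype V] in
/-- Set bookkeeping along a split `D = pre' ++ d :: ds''`. [folklore] -/
theorem insert_union_split (x d : V) (Y : Set V) (pre' ds'' : List V) :
    (insert d (insert x Y ∪ {e | e ∈ pre'}) ∪ {e | e ∈ ds''} : Set V) = insert x Y ∪ {e | e ∈ pre' ++ d :: ds''} := by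
  ext a
  simp only [mem_union, mem_insert_iff, mem_setOf_eq, List.mem_append, List.mem_cons]
  tauto

omit [Fintype V] in
/-- Set bookkeeping: `↑({x} ∪ D) ∪ Y = {x} ∪ Y ∪ D`. [folklore] -/
theorem coe_insert_toFinset_union (x : V) (Y : Set V) (D : List V) :
    (↑(insert x D.toFinset : Finset V) ∪ Y : Set V) = insert x Y ∪ {d | d ∈ D} := by
  ext a
  simp only [mem_union, Finset.coe_insert, mem_insert_iff, Finset.mem_coe, List.mem_toFinset, mem_setOf_eq]
  tauto

/-- The world covariance is additive in the second slot. [folklore] -/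
theorem wcovOff_add_second (w : Sym2 V → ℝ) (Y : Set V) (φ ψ χ : Set (Sym2 V) → ℝ) (ω : Set (Sym2 V)) :
    wcovOff w Y φ (fun ζ => ψ ζ + χ ζ) ω = wcovOff w Y φ ψ ω + wcovOff w Y φ χ ω := by
  rw [wcovOff_eq_sum, wcovOff_eq_sum, wcovOff_eq_sum, ← Finset.sum_add_distrib]
  exact Finset.sum_congr rfl fun η _ => by ring

omit [Fintype V] in
/-- The empty configuration avoids every set not containing the source. [folklore] -/
theorem empty_mem_avoidEv {d : V} {T : Set V} (h : d ∉ T) : (∅ : Set (Sym2 V)) ∈ avoidEv d T := by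
  intro t ht hreach
  have hbot : openGraph (∅ : BondConfig V) = ⊥ := by
    unfold openGraph; exact SimpleGraph.fromEdgeSet_empty
  rw [hbot, SimpleGraph.reachable_bot] at hreach
  exact h (hreach ▸ ht)

/-- Lemma Φ's functional read on the edge cluster of the decoy equals prim-ineq-prove-1's `CSH.phiS`. [folklore] -/
theorem phiFun_span_openEdgeCluster (w : Sym2 V → unitInterval) (x : V) (Y : Set V) (g : Set (Sym2 V) → ℝ) (d : V)
    (ζ : Set (Sym2 V)) :
    phiFun w x Y g {a | a = d ∨ ∃ e ∈ openEdgeCluster ζ d, a ∈ e} = phiS (fun e => (w e : ℝ)) x Y g d ζ := by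
  rw [clusterFun_openEdgeCluster (phiFun w x Y g) ζ d, phiFun, phiS]
  exact (sum_weight_mul_eq_integral w _).symm

/-- **The decoy part of the world-wise unfolding is nonpositive given the lower-level margins** (memo §3.3–3.5: each decoy `d_j` contributes
`−μ(E_j)⁻¹ · Marg_{L_{>j}}[covD_{d_j | {x}∪Y∪D_{<j}}(Φ̃)]`, `Φ̃` monotone `≥ 0`).  Induction along the remaining decoys `ds'` with the consumed prefix
`pre` (source set `{x} ∪ pre`, avoided set `{x} ∪ Y ∪ pre` for the constants).
[cite: VandenbergHaggstromKahn2005, §2.1 Lemma 2.4 (p. 10)] [cite: KozmaNitzan2024, Conj. 4 (p. 32)] -/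
theorem unfoldT_world_nonpos (w : Sym2 V → unitInterval) (hw : ∀ e, 0 < w e ∧ w e < 1) (x : V) (Y : Set V) (o v : V)
    (g : Set (Sym2 V) → ℝ) (hg : Monotone g) (p : ℝ) :
    ∀ (ds' pre : List V), (pre ++ ds').Nodup → (∀ d ∈ pre ++ ds', d ∉ insert x Y ∧ d ≠ o ∧ d ≠ v) →
      (∀ (pre' : List V) (d : V) (ds'' : List V), pre ++ ds' = pre' ++ d :: ds'' →
        ∀ h : Set (Sym2 V) → ℝ, Monotone h → (∀ C, 0 ≤ h C) →
          0 ≤ cshMarg (decoyList w (insert d (insert x Y ∪ {e | e ∈ pre'})) ds'') p o v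
            (covD w d (insert x Y ∪ {e | e ∈ pre'}) h)) →
      ∑ ω, weight (fun e => (w e : ℝ)) ω * (ind (avoidEv x Y) ω *
          wcovOff (fun e => (w e : ℝ)) Y (fun β => g (openEdgeCluster β x))
            (fun ζ => unfoldT (openGraph ζ).Reachable (insert x {e | e ∈ pre})
                (decoyList w (insert x Y ∪ {e | e ∈ pre}) ds') o -
              p * unfoldT (openGraph ζ).Reachable (insert x {e | e ∈ pre})
                (decoyList w (insert x Y ∪ {e | e ∈ pre}) ds') v) ω) ≤ 0 := by
  have hm : ∑ ω, weight (fun e => (w e : ℝ)) ω = 1 := sum_weight_coe_eq_one w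
  intro ds'
  induction ds' with
  | nil =>
    intro pre _ _ _
    have h0 : (fun ζ : Set (Sym2 V) => unfoldT (openGraph ζ).Reachable (insert x {e | e ∈ pre})
          (decoyList w (insert x Y ∪ {e | e ∈ pre}) []) o -
        p * unfoldT (openGraph ζ).Reachable (insert x {e | e ∈ pre}) (decoyList w (insert x Y ∪ {e | e ∈ pre}) []) v) =
        fun _ => (0 : ℝ) := by
      funext ζ; simp [decoyList, unfoldT]
    rw [h0]
    simp only [wcovOff_const_right _ hm, mul_zero, Finset.sum_const_zero, le_refl]
  | cons d ds'' ih =>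
    intro pre hnd hdis hlow
    -- bookkeeping on the named vertices
    have hdmem : d ∈ pre ++ d :: ds'' := List.mem_append_right pre List.mem_cons_self
    have hdx : d ≠ x := fun h => (hdis d hdmem).1 (h ▸ mem_insert x Y)
    have hdo : o ≠ d := fun h => (hdis d hdmem).2.1 h.symm
    have hdv : v ≠ d := fun h => (hdis d hdmem).2.2 h.symm
    have hnd' := List.nodup_append.1 hnd
    have hd_pre : d ∉ pre := fun hdp => hnd'.2.2 d hdp d List.mem_cons_self rfl
    have hd_ds'' : d ∉ ds'' := (List.nodup_cons.1 hnd'.2.1).1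
    have hxS : x ∈ (insert x {e | e ∈ pre} : Set V) := mem_insert x _
    have hdS : d ∉ (insert x {e | e ∈ pre} : Set V) := by
      rintro (h | h)
      · exact hdx h
      · exact hd_pre h
    have hdA : d ∉ (insert x Y ∪ {e | e ∈ pre} : Set V) := by
      rintro (h | h)
      · exact (hdis d hdmem).1 h
      · exact hd_pre h
    have hSY : (insert x {e | e ∈ pre} ∪ Y : Set V) = insert x Y ∪ {e | e ∈ pre} := insert_setOf_union x Y pre
    have hS' : (insert d (insert x {e | e ∈ pre}) : Set V) = insert x {e | e ∈ pre ++ [d]} := insert_insert_setOf_mem_append x d pre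
    have hA' : (insert d (insert x Y ∪ {e | e ∈ pre}) : Set V) = insert x Y ∪ {e | e ∈ pre ++ [d]} :=
      insert_union_setOf_mem_append x d Y pre
    have hlist : decoyList w (insert x Y ∪ {e | e ∈ pre}) (d :: ds'') =
        (d, avoidConst w d (insert x Y ∪ {e | e ∈ pre})) ::
          decoyList w (insert d (insert x Y ∪ {e | e ∈ pre})) ds'' := rfl
    have hL''fst : ∀ dc ∈ decoyList w (insert d (insert x Y ∪ {e | e ∈ pre})) ds'', dc.1 ≠ d := by
      intro dc hdc heq
      have : dc.1 ∈ (decoyList w (insert d (insert x Y ∪ {e | e ∈ pre})) ds'').map Prod.fst := List.mem_map.2 ⟨dc, hdc, rfl⟩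
      rw [map_fst_decoyList] at this
      exact hd_ds'' (heq ▸ this)
    -- induction hypothesis for the tail (prefix `pre ++ [d]`)
    have hih := ih (pre ++ [d]) (by simpa using hnd) (by simpa using hdis)
      (fun pre' d' ds''' hsplit => hlow pre' d' ds''' (by simpa using hsplit))
    rw [← hS', ← hA'] at hih
    -- masses of the avoidance event of `d`
    have hm₀eq : ∑ ζ, weight (fun e => (w e : ℝ)) ζ * ind (avoidEv d (insert x {e | e ∈ pre} ∪ Y)) ζ =
        (prodBernoulli w).real {ζ : BondConfig V | ∀ a ∈ (insert x Y ∪ {e | e ∈ pre} : Set V), ¬ (openGraph ζ).Reachable d a} := by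
      rw [hSY, sum_weight_ind]; rfl
    have hm₁eq : ∀ u : V, ∑ ζ, weight (fun e => (w e : ℝ)) ζ * ind (avoidEv d (insert x {e | e ∈ pre} ∪ Y) ∩ openConn d u) ζ =
        (prodBernoulli w).real ({ζ : BondConfig V | ∀ a ∈ (insert x Y ∪ {e | e ∈ pre} : Set V), ¬ (openGraph ζ).Reachable d a} ∩
          openConn d u) := by
      intro u; rw [hSY, sum_weight_ind]; rfl
    have hm₀pos : 0 < (prodBernoulli w).real
        {ζ : BondConfig V | ∀ a ∈ (insert x Y ∪ {e | e ∈ pre} : Set V), ¬ (openGraph ζ).Reachable d a} :=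
      prodBernoulli_real_pos_of_nonempty hw ⟨∅, empty_mem_avoidEv hdA⟩
    have hm₀ : ∑ ζ, weight (fun e => (w e : ℝ)) ζ * ind (avoidEv d (insert x {e | e ∈ pre} ∪ Y)) ζ ≠ 0 := by
      rw [hm₀eq]; exact hm₀pos.ne'
    have hcw : ∀ u, avoidConst w d (insert x Y ∪ {e | e ∈ pre}) u =
        (∑ ζ, weight (fun e => (w e : ℝ)) ζ * ind (avoidEv d (insert x {e | e ∈ pre} ∪ Y) ∩ openConn d u) ζ) /
          ∑ ζ, weight (fun e => (w e : ℝ)) ζ * ind (avoidEv d (insert x {e | e ∈ pre} ∪ Y)) ζ := by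
      intro u; rw [hm₁eq, hm₀eq]; rfl
    -- the decoy term via `decoy_world_term`
    have hterm : ∀ u : V, u ≠ d →
        ∑ ω, weight (fun e => (w e : ℝ)) ω * (ind (avoidEv x Y) ω * wcovOff (fun e => (w e : ℝ)) Y (fun β => g (openEdgeCluster β x))
          (fun ζ => av (openGraph ζ).Reachable (insert x {e | e ∈ pre}) d *
            slForm (decoyList w (insert d (insert x Y ∪ {e | e ∈ pre})) ds'')
              (fun u' => chi (openGraph ζ).Reachable u' d - avoidConst w d (insert x Y ∪ {e | e ∈ pre}) u') u) ω) =
        - ((∑ ζ, weight (fun e => (w e : ℝ)) ζ * ind (avoidEv d (insert x {e | e ∈ pre} ∪ Y)) ζ)⁻¹ *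
          slForm (decoyList w (insert d (insert x Y ∪ {e | e ∈ pre})) ds'') (fun u' =>
            (∑ ζ, weight (fun e => (w e : ℝ)) ζ * ind (avoidEv d (insert x {e | e ∈ pre} ∪ Y)) ζ) *
                (∑ ζ, weight (fun e => (w e : ℝ)) ζ * (ind (avoidEv d (insert x {e | e ∈ pre} ∪ Y) ∩ openConn d u') ζ *
                  phiS (fun e => (w e : ℝ)) x Y g d ζ)) -
              (∑ ζ, weight (fun e => (w e : ℝ)) ζ * ind (avoidEv d (insert x {e | e ∈ pre} ∪ Y) ∩ openConn d u') ζ) *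
                (∑ ζ, weight (fun e => (w e : ℝ)) ζ * (ind (avoidEv d (insert x {e | e ∈ pre} ∪ Y)) ζ *
                  phiS (fun e => (w e : ℝ)) x Y g d ζ))) u) :=
      fun u hu => decoy_world_term _ hm x Y g hxS hdS _ hL''fst hu _ hm₀ hcw
    -- the bracket is the denominator-free covariance of the edge-cluster reading `Φe` of `Φ`
    have hΦe_mono : Monotone (fun C : Set (Sym2 V) => phiFun w x Y g {a | a = d ∨ ∃ e ∈ C, a ∈ e}) :=
      monotone_clusterFun d (phiFun w x Y g) (fun K K' hKK' => phiFun_mono w x Y hg hKK')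
    have hΦe_nonneg : ∀ C : Set (Sym2 V), 0 ≤ phiFun w x Y g {a | a = d ∨ ∃ e ∈ C, a ∈ e} :=
      fun C => phiFun_nonneg w x Y hg _
    have hQ : (fun u' =>
        (∑ ζ, weight (fun e => (w e : ℝ)) ζ * ind (avoidEv d (insert x {e | e ∈ pre} ∪ Y)) ζ) *
            (∑ ζ, weight (fun e => (w e : ℝ)) ζ * (ind (avoidEv d (insert x {e | e ∈ pre} ∪ Y) ∩ openConn d u') ζ *
              phiS (fun e => (w e : ℝ)) x Y g d ζ)) -
          (∑ ζ, weight (fun e => (w e : ℝ)) ζ * ind (avoidEv d (insert x {e | e ∈ pre} ∪ Y) ∩ openConn d u') ζ) *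
            (∑ ζ, weight (fun e => (w e : ℝ)) ζ * (ind (avoidEv d (insert x {e | e ∈ pre} ∪ Y)) ζ *
              phiS (fun e => (w e : ℝ)) x Y g d ζ))) =
        covD w d (insert x Y ∪ {e | e ∈ pre}) (fun C : Set (Sym2 V) => phiFun w x Y g {a | a = d ∨ ∃ e ∈ C, a ∈ e}) := by
      funext u'
      have hAv : avoidEv d (insert x Y ∪ {e | e ∈ pre}) =
          {ζ : BondConfig V | ∀ a ∈ (insert x Y ∪ {e | e ∈ pre} : Set V), ¬ (openGraph ζ).Reachable d a} := rfl
      have e1 : ∑ ζ, weight (fun e => (w e : ℝ)) ζ * (ind (avoidEv d (insert x {e | e ∈ pre} ∪ Y) ∩ openConn d u') ζ *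
            phiS (fun e => (w e : ℝ)) x Y g d ζ) =
          ∫ ζ in {ζ : BondConfig V | ∀ a ∈ (insert x Y ∪ {e | e ∈ pre} : Set V), ¬ (openGraph ζ).Reachable d a} ∩ openConn d u',
            phiFun w x Y g {a | a = d ∨ ∃ e ∈ openEdgeCluster ζ d, a ∈ e} ∂(prodBernoulli w) := by
        rw [← sum_weight_mul_ind, hSY]
        exact Finset.sum_congr rfl fun ζ _ => by rw [phiFun_span_openEdgeCluster, hAv]; ring
      have e2 : ∑ ζ, weight (fun e => (w e : ℝ)) ζ * (ind (avoidEv d (insert x {e | e ∈ pre} ∪ Y)) ζ *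
            phiS (fun e => (w e : ℝ)) x Y g d ζ) =
          ∫ ζ in {ζ : BondConfig V | ∀ a ∈ (insert x Y ∪ {e | e ∈ pre} : Set V), ¬ (openGraph ζ).Reachable d a},
            phiFun w x Y g {a | a = d ∨ ∃ e ∈ openEdgeCluster ζ d, a ∈ e} ∂(prodBernoulli w) := by
        rw [← sum_weight_mul_ind, hSY]
        exact Finset.sum_congr rfl fun ζ _ => by rw [phiFun_span_openEdgeCluster, hAv]; ring
      rw [hm₀eq, hm₁eq, e1, e2, covD]
      ring
    -- split the test function: decoy term + tail
    have hcov : ∀ ω : Set (Sym2 V), wcovOff (fun e => (w e : ℝ)) Y (fun β => g (openEdgeCluster β x))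
        (fun ζ => unfoldT (openGraph ζ).Reachable (insert x {e | e ∈ pre})
            (decoyList w (insert x Y ∪ {e | e ∈ pre}) (d :: ds'')) o -
          p * unfoldT (openGraph ζ).Reachable (insert x {e | e ∈ pre})
            (decoyList w (insert x Y ∪ {e | e ∈ pre}) (d :: ds'')) v) ω =
        (1 * wcovOff (fun e => (w e : ℝ)) Y (fun β => g (openEdgeCluster β x))
            (fun ζ => av (openGraph ζ).Reachable (insert x {e | e ∈ pre}) d *
              slForm (decoyList w (insert d (insert x Y ∪ {e | e ∈ pre})) ds'')
                (fun u' => chi (openGraph ζ).Reachable u' d - avoidConst w d (insert x Y ∪ {e | e ∈ pre}) u') o) ω -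
          p * wcovOff (fun e => (w e : ℝ)) Y (fun β => g (openEdgeCluster β x))
            (fun ζ => av (openGraph ζ).Reachable (insert x {e | e ∈ pre}) d *
              slForm (decoyList w (insert d (insert x Y ∪ {e | e ∈ pre})) ds'')
                (fun u' => chi (openGraph ζ).Reachable u' d - avoidConst w d (insert x Y ∪ {e | e ∈ pre}) u') v) ω) +
        wcovOff (fun e => (w e : ℝ)) Y (fun β => g (openEdgeCluster β x))
          (fun ζ => unfoldT (openGraph ζ).Reachable (insert d (insert x {e | e ∈ pre}))
              (decoyList w (insert d (insert x Y ∪ {e | e ∈ pre})) ds'') o -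
            p * unfoldT (openGraph ζ).Reachable (insert d (insert x {e | e ∈ pre}))
              (decoyList w (insert d (insert x Y ∪ {e | e ∈ pre})) ds'') v) ω := by
      intro ω
      have e : (fun ζ : Set (Sym2 V) => unfoldT (openGraph ζ).Reachable (insert x {e | e ∈ pre})
            (decoyList w (insert x Y ∪ {e | e ∈ pre}) (d :: ds'')) o -
          p * unfoldT (openGraph ζ).Reachable (insert x {e | e ∈ pre})
            (decoyList w (insert x Y ∪ {e | e ∈ pre}) (d :: ds'')) v) =
          fun ζ => (1 * (av (openGraph ζ).Reachable (insert x {e | e ∈ pre}) d *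
              slForm (decoyList w (insert d (insert x Y ∪ {e | e ∈ pre})) ds'')
                (fun u' => chi (openGraph ζ).Reachable u' d - avoidConst w d (insert x Y ∪ {e | e ∈ pre}) u') o) -
            p * (av (openGraph ζ).Reachable (insert x {e | e ∈ pre}) d *
              slForm (decoyList w (insert d (insert x Y ∪ {e | e ∈ pre})) ds'')
                (fun u' => chi (openGraph ζ).Reachable u' d - avoidConst w d (insert x Y ∪ {e | e ∈ pre}) u') v)) +
          (unfoldT (openGraph ζ).Reachable (insert d (insert x {e | e ∈ pre}))
              (decoyList w (insert d (insert x Y ∪ {e | e ∈ pre})) ds'') o -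
            p * unfoldT (openGraph ζ).Reachable (insert d (insert x {e | e ∈ pre}))
              (decoyList w (insert d (insert x Y ∪ {e | e ∈ pre})) ds'') v) := by
        funext ζ; rw [hlist]; simp only [unfoldT]; ring
      rw [e, wcovOff_add_second, wcovOff_lin₂]
    simp_rw [hcov]
    have hsum : ∀ (a b c' : Set (Sym2 V) → ℝ),
        ∑ ω, weight (fun e => (w e : ℝ)) ω * (ind (avoidEv x Y) ω * ((1 * a ω - p * b ω) + c' ω)) =
          (∑ ω, weight (fun e => (w e : ℝ)) ω * (ind (avoidEv x Y) ω * a ω)) -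
            p * (∑ ω, weight (fun e => (w e : ℝ)) ω * (ind (avoidEv x Y) ω * b ω)) +
          ∑ ω, weight (fun e => (w e : ℝ)) ω * (ind (avoidEv x Y) ω * c' ω) := by
      intro a b c'
      rw [Finset.mul_sum, ← Finset.sum_sub_distrib, ← Finset.sum_add_distrib]
      exact Finset.sum_congr rfl fun ω _ => by ring
    rw [hsum, hterm o hdo, hterm v hdv, hQ]
    -- the decoy term is `−m₀⁻¹ · (lower margin) ≤ 0`
    have hlow0 := hlow pre d ds'' rfl _ hΦe_mono hΦe_nonneg
    rw [cshMarg] at hlow0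
    have hinv : 0 ≤ (∑ ζ, weight (fun e => (w e : ℝ)) ζ * ind (avoidEv d (insert x {e | e ∈ pre} ∪ Y)) ζ)⁻¹ := by
      rw [hm₀eq]; exact inv_nonneg.2 hm₀pos.le
    nlinarith [mul_nonneg hinv hlow0, hih]

end Summit.CriticalPhenomena.PercolationContinuityZ3.Theorems.CSH

end
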